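import Mathlib.NumberTheory.AbelSummation
import Mathlib.MeasureTheory.Integral.IntervalIntegral.IntegrationByParts
import Literature.NumberTheory.LFunctions.TaoLogChowla
import Literature.NumberTheory.LFunctions.MertensTail
import Literature.NumberTheory.Sieve.MoebiusShiftedPrimesPrimeCharacterSum
import Literature.NumberTheory.LFunctions.ExpSumBoundReduction
import Literature.NumberTheory.LFunctions.VinogradovZetaSum
import Literature.NumberTheory.LFunctions.VinogradovMeanValueTheorem
import HarnessLib

/-!
# Matomäki–Radziwiłł–Tao 2015, (1.12): the non-pretentiousness bound for `λ` from the
# Vinogradov–Korobov zero-free region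

Topic `Literature/NumberTheory/LFunctions`.  Everything in this file is PROVED.  It discharges the
named fact `Literature.NumberTheory.LFunctions.MatomakiRadziwillTao2015_liouvilleDistLowerBound`
(`TaoLogChowla.lean`; Matomäki–Radziwiłł–Tao, Algebra & Number Theory 9 (2015), §1, eq. (1.12), the
display following Theorem 1.6: for every `ε > 0`,
`inf_{|t| ≤ X, q ≤ (log X)^{1/125}, χ (q)} ∑_{exp((log X)^{2/3+ε}) ≤ p ≤ X} (1 + Re χ(p)p^{it})/p
≥ (1/3 − ε) log log X + O(1)`) — **unconditionally** (`MatomakiRadziwillTao2015_liouvilleDistLowerBound_holds`,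
added 2026-08-15: the Vinogradov–Korobov region is now a theorem of the tree, see the last bullet) — by first
proving it from the
Vinogradov–Korobov zero-free region for Dirichlet `L`-functions — taken in the interface form
`(hc : 0 < c) (hVK : HasVKZeroFreeRegion c T₀)` of `VinogradovKorobovDirichlet.lean` (the inexplicit
printed shape, Khale (1.4) = Montgomery, *Ten lectures*, p. 176: ANY constant `c > 0`, any starting
height `T₀`), with Khale's explicit Theorem 1.1
(`Literature.NumberTheory.LFunctions.Khale2024_zeroFreeRegion`) as a special case:

* `MatomakiRadziwillTao2015_liouvilleDistLowerBound_of_vk :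
    0 < c → HasVKZeroFreeRegion c T₀ → MatomakiRadziwillTao2015_liouvilleDistLowerBound`;
* `MatomakiRadziwillTao2015_liouvilleDistLowerBound_of_khale :
    Khale2024_zeroFreeRegion → MatomakiRadziwillTao2015_liouvilleDistLowerBound`.

* `MatomakiRadziwillTao2015_liouvilleDistLowerBound_of_expSumBound :
    ExpSumBound C D → 0 ≤ C → 0 < D → MatomakiRadziwillTao2015_liouvilleDistLowerBound` — from
  Vinogradov's exponential-sum estimate in the shape of Ford's Theorem 2 with unspecified constants
  (`RichertBoundsFromExpSum.lean`: exponential sums ⟹ Richert-type bounds ⟹ zero-free region,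
  `hasVKZeroFreeRegion_of_expSumBound`).

* `MatomakiRadziwillTao2015_liouvilleDistLowerBound_of_vinogradovRange :
    1 ≤ K → 0 ≤ C → 0 < c → VinogradovRangeBound K C c → MatomakiRadziwillTao2015_liouvilleDistLowerBound`
  — from Vinogradov's estimate in its natural range `λ = log t/log N ≥ K + 1/2` only
  (`ExpSumBoundReduction.lean`: the range of bounded `λ` is van der Corput's, proved there).

* `MatomakiRadziwillTao2015_liouvilleDistLowerBound_holds` — **the unconditional discharge**: the tree
  proves Vinogradov's mean value theorem in the shape of Ivić's Lemma 6.3 (`vmvtBound_thirtyTwo :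
  VMVTBound 32`, `VinogradovMeanValueTheorem.lean`) and, from it, Ivić's Theorem 6.2 for the shifted zeta
  sums `∑ (n + u)^{-it}` and hence `∃ c > 0, HasVKZeroFreeRegion c 21`
  (`VinogradovZetaSum.hasVKZeroFreeRegion_of_vmvtBound`, `VinogradovZetaSum.lean`, through
  `hasVKZeroFreeRegion_of_vinogradovRange`; independently also `VKZeta.exists_hasVKZeroFreeRegion`,
  `VinogradovZetaSumEstimate.lean`), and `…_of_vk` does the rest.  Khale's EXPLICIT Theorem 1.1
  (`Khale2024_zeroFreeRegion`, constants `10.5`, `61.5`, `|t| ≥ 10`) is therefore not needed for this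
  fact (nor for any `…_of_khale` theorem of the tree, each of which is the specialisation of an `…_of_vk`
  theorem): the `…_of_khale` form below is kept only because other files still reference it.

The source proves (1.12) in one sentence: "the last inequality is established via standard methods
from the Vinogradov–Korobov type zero-free region `σ > 1 − c/max{log q, (log(3+|t|))^{2/3}
(log log(3+|t|))^{1/3}}` for `L(s, χ)` …, which applies since `χ` has conductor
`q ≤ (log X)^{1/125}`".  The "standard methods" are carried out here.

## The argument

Write `y = exp((log X)^θ)`, `θ = 2/3 + ε`, and split the summand: `∑_{y ≤ p ≤ X} 1/p ≥ log log X −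
log log y − 6/log y = (1/3 − ε) log log X − O(1)` is Mertens' theorem in the tail form of the tree
(`MertensBound.loglog_sub_loglog_le_sum_inv_prime_Icc`, `MertensTail.lean`), so (1.12) amounts to
`Re ∑_{y ≤ p ≤ X} χ(p)p^{it}/p ≥ −O(1)` uniformly in `q ≤ (log X)^{1/125}`, `χ`, `|t| ≤ X`
(`MRT2015DistLowerBound.re_primeCharSum_ge`, with the constant `4`).  For this, Abel summation with the
weight `f(u) = 1/(u log u)` (Mathlib's `sum_mul_eq_sub_sub_integral_mul'`, in the set-up of
`Lichtman2020.PrimeCharSum`, `MoebiusShiftedPrimesPrimeCharacterSum.lean`) is applied to the prime sums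
`D(u) = ∑_{p ≤ u} χ(p) log p · p^{-it}`, which by the twisted prime number theorem in the
Vinogradov–Korobov range (`TwistedVonMangoldt.twisted_sum_estimate_of_vk`,
`TwistedVonMangoldtSum.lean`, proved from the zero-free region) and `ψ(u) − ϑ(u) ≤ 2√u log u` satisfy
`D(u) = M(u) + O(u/(log X)²)`, `M(u) = δ_χ u^{1−it}/(1 − it)`, for `y/2 ≤ u ≤ X`.  The error terms
contribute at most `4/(log X)² + 4/log X ≤ 1`.  The main term is **kept** (the norm bound
`≪ log X/(1 + |t|)` of Lichtman's Lemma 4.5 is useless for `|t| ≤ log X`): integrating by parts back,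
`f(m)M(m) − f(n)M(n) − ∫ₙᵐ f′M = ∫ₙᵐ f M′ = δ_χ ∫ₙᵐ u^{-it} du/(u log u)`, whose real part is
`δ_χ ∫_{log n}^{log m} cos(tv) dv/v ≥ −3` by the elementary bound `∫_α^β cos w dw/w ≥ −3`
(`0 < α ≤ β`; integrand `≥ 0` on `(0, 1]`, integration by parts on `[1, ∞)`).

## References

* K. Matomäki, M. Radziwiłł, T. Tao, *An averaged form of Chowla's conjecture*, Algebra & Number
  Theory 9 (2015), 2167–2196; arXiv:1503.05121, §1, (1.12) (display following Theorem 1.6).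
  [MatomakiRadziwillTao2015]
* T. Khale, *An explicit Vinogradov–Korobov zero-free region for Dirichlet L-functions*, Q. J. Math.
  75 (2024), 299–332 (arXiv:2210.06457), Theorem 1.1 and display (1.4). [Khale2024]
* J. D. Lichtman, *Averages of the Möbius function on shifted primes*, arXiv:2009.08969, Lemma 4.5
  (the partial-summation set-up reused here). [Lichtman2020]
* G. H. Hardy, E. M. Wright, *An Introduction to the Theory of Numbers*, Thm 427 (Mertens). [HardyWright2008]

## Design choices

* No new definitions and no new named facts: the file only adds theorems (D-0026).
* All constants are explicit but not optimised (`C = 10` in (1.12): `6` from Mertens' tail bound and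
  `4` from the twisted prime sums); thresholds are existential (`∀ᶠ X in atTop`).
-/

noncomputable section

open MeasureTheory Set intervalIntegral Complex Filter Topology

namespace Literature.NumberTheory.LFunctions

namespace MRT2015DistLowerBound

open Literature.NumberTheory.Sieve.Lichtman2020.PrimeCharSum TwistedVonMangoldt

/-! ### The cosine integral `∫ cos w dw/w` is bounded below -/

/-- `w ↦ cos w / w` is continuous on any interval `[α, β]` with `α > 0`. [folklore] -/
theorem continuousOn_cos_div {α β : ℝ} (hα : 0 < α) (hαβ : α ≤ β) :
    ContinuousOn (fun w : ℝ => Real.cos w / w) (uIcc α β) := by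
  refine Real.continuous_cos.continuousOn.div continuousOn_id fun w hw => ?_
  rw [uIcc_of_le hαβ] at hw
  exact (hα.trans_le hw.1).ne'

/-- For `1 ≤ α ≤ β`: `∫_α^β cos w / w dw ≥ -3` (integration by parts:
`= [sin w / w]_α^β + ∫_α^β sin w / w² dw`, each of the three terms of modulus `≤ 1`). [folklore] -/
theorem integral_cos_div_ge_of_one_le {α β : ℝ} (hα : 1 ≤ α) (hαβ : α ≤ β) :
    -3 ≤ ∫ w in α..β, Real.cos w / w := by
  have hmem : ∀ x ∈ uIcc α β, 1 ≤ x := fun x hx => by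
    rw [uIcc_of_le hαβ] at hx; exact hα.trans hx.1
  have hu : ∀ x ∈ uIcc α β, HasDerivAt (fun w : ℝ => w⁻¹) (-(x ^ 2)⁻¹) x := fun x hx =>
    hasDerivAt_inv (by linarith [hmem x hx])
  have hv : ∀ x ∈ uIcc α β, HasDerivAt Real.sin (Real.cos x) x := fun x _ => Real.hasDerivAt_sin x
  have hsqcont : ContinuousOn (fun w : ℝ => (w ^ 2)⁻¹) (uIcc α β) := by
    refine ContinuousOn.inv₀ (continuousOn_pow 2) fun x hx => ?_
    exact pow_ne_zero 2 (by linarith [hmem x hx])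
  have hu' : IntervalIntegrable (fun w : ℝ => -(w ^ 2)⁻¹) volume α β :=
    hsqcont.neg.intervalIntegrable
  have hv' : IntervalIntegrable Real.cos volume α β := Real.continuous_cos.intervalIntegrable _ _
  have hibp := intervalIntegral.integral_mul_deriv_eq_deriv_mul hu hv hu' hv'
  have heq : ∫ w in α..β, Real.cos w / w = ∫ w in α..β, w⁻¹ * Real.cos w :=
    intervalIntegral.integral_congr fun w _ => by simp [div_eq_inv_mul]
  rw [heq, hibp]
  have hβ : 1 ≤ β := hα.trans hαβ
  have hbdry : ∀ x : ℝ, 1 ≤ x → |x⁻¹ * Real.sin x| ≤ 1 := by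
    intro x hx
    rw [abs_mul, abs_inv, abs_of_pos (by linarith)]
    calc x⁻¹ * |Real.sin x| ≤ 1 * 1 :=
          mul_le_mul (inv_le_one_of_one_le₀ hx) (Real.abs_sin_le_one x) (abs_nonneg _) zero_le_one
      _ = 1 := one_mul _
  have h1 := abs_le.1 (hbdry β hβ)
  have h2 := abs_le.1 (hbdry α hα)
  -- the integral term
  have hanti : ∫ x in α..β, (x ^ 2)⁻¹ = α⁻¹ - β⁻¹ := by
    have hd : ∀ x ∈ uIcc α β, HasDerivAt (fun w : ℝ => -w⁻¹) ((x ^ 2)⁻¹) x := by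
      intro x hx
      have h0 := (hasDerivAt_inv (by linarith [hmem x hx] : x ≠ 0)).fun_neg
      rwa [neg_neg] at h0
    rw [intervalIntegral.integral_eq_sub_of_hasDerivAt hd hsqcont.intervalIntegrable]
    ring
  have h3 : |∫ x in α..β, -(x ^ 2)⁻¹ * Real.sin x| ≤ 1 := by
    rw [← Real.norm_eq_abs]
    calc ‖∫ x in α..β, -(x ^ 2)⁻¹ * Real.sin x‖ ≤ ∫ x in α..β, (x ^ 2)⁻¹ := by
          refine intervalIntegral.norm_integral_le_of_norm_le hαβ (ae_of_all _ fun x hx => ?_)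
            hsqcont.intervalIntegrable
          have hx1 : 1 ≤ x := hα.trans hx.1.le
          rw [norm_mul, norm_neg, norm_inv, norm_pow, Real.norm_eq_abs, abs_of_pos (by linarith),
            Real.norm_eq_abs]
          calc (x ^ 2)⁻¹ * |Real.sin x| ≤ (x ^ 2)⁻¹ * 1 :=
                mul_le_mul_of_nonneg_left (Real.abs_sin_le_one x) (by positivity)
            _ = (x ^ 2)⁻¹ := mul_one _
      _ = α⁻¹ - β⁻¹ := hanti
      _ ≤ 1 := by
          have : α⁻¹ ≤ 1 := inv_le_one_of_one_le₀ hα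
          have : 0 ≤ β⁻¹ := inv_nonneg.2 (by linarith)
          linarith
  have h3' := abs_le.1 h3
  linarith [h1.1, h1.2, h2.1, h2.2, h3'.1, h3'.2]

/-- For `0 < α ≤ β ≤ 1` the integrand `cos w / w` is nonnegative (`[0, 1] ⊂ [-π/2, π/2]`), so
`∫_α^β cos w / w dw ≥ 0`. [folklore] -/
theorem integral_cos_div_nonneg_of_le_one {α β : ℝ} (hα : 0 < α) (hαβ : α ≤ β) (hβ : β ≤ 1) :
    0 ≤ ∫ w in α..β, Real.cos w / w := by
  refine intervalIntegral.integral_nonneg hαβ fun w hw => ?_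
  have hw0 : 0 < w := hα.trans_le hw.1
  have hw1 : w ≤ 1 := hw.2.trans hβ
  refine div_nonneg (Real.cos_nonneg_of_neg_pi_div_two_le_of_le ?_ ?_) hw0.le
  · linarith [Real.pi_pos]
  · linarith [Real.pi_gt_three]

/-- **The cosine integral is bounded below**: `∫_α^β cos w / w dw ≥ -3` for `0 < α ≤ β`.
[folklore] -/
theorem integral_cos_div_ge {α β : ℝ} (hα : 0 < α) (hαβ : α ≤ β) :
    -3 ≤ ∫ w in α..β, Real.cos w / w := by
  rcases le_or_gt β 1 with hβ | hβ
  · linarith [integral_cos_div_nonneg_of_le_one hα hαβ hβ]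
  rcases le_or_gt 1 α with hα1 | hα1
  · exact integral_cos_div_ge_of_one_le hα1 hαβ
  -- `α < 1 < β`: split at `1`
  have hint : ∀ a b : ℝ, α ≤ a → a ≤ b → IntervalIntegrable (fun w : ℝ => Real.cos w / w) volume a b :=
    fun a b ha hab => (continuousOn_cos_div (hα.trans_le ha) hab).intervalIntegrable
  rw [← intervalIntegral.integral_add_adjacent_intervals (hint α 1 le_rfl hα1.le)
    (hint 1 β hα1.le hβ.le)]
  linarith [integral_cos_div_nonneg_of_le_one hα hα1.le le_rfl,
    integral_cos_div_ge_of_one_le le_rfl hβ.le]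

/-- `∫_a^b cos(t v) / v dv ≥ -3` for `0 < a ≤ b` and every real `t` (scale `w = |t| v`; for `t = 0`
the integrand is positive). [folklore] -/
theorem integral_cos_mul_div_ge (t : ℝ) {a b : ℝ} (ha : 0 < a) (hab : a ≤ b) :
    -3 ≤ ∫ v in a..b, Real.cos (t * v) / v := by
  -- reduce to `t > 0`
  wlog ht : 0 ≤ t generalizing t with H
  · have h := H (-t) (by linarith)
    simpa [neg_mul, Real.cos_neg] using h
  rcases ht.eq_or_lt with rfl | ht
  · have : 0 ≤ ∫ v in a..b, Real.cos (0 * v) / v :=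
      intervalIntegral.integral_nonneg hab fun v hv => by
        simpa using (ha.trans_le hv.1).le
    linarith
  -- `t > 0`: substitute `w = t v`
  have hsub : ∫ v in a..b, Real.cos (t * v) / v = ∫ w in t * a..t * b, Real.cos w / w := by
    rw [← intervalIntegral.mul_integral_comp_mul_left, ← intervalIntegral.integral_const_mul]
    refine intervalIntegral.integral_congr fun v hv => ?_
    rw [uIcc_of_le hab] at hv
    have hv0 : v ≠ 0 := (ha.trans_le hv.1).ne'
    field_simp
  rw [hsub]
  exact integral_cos_div_ge (by positivity) (by nlinarith)

/-! ### The main term: substitution `v = log u` and its real part -/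

/-- The substitution `v = log u`: `∫_x^y cos(t log u)/(u log u) du = ∫_{log x}^{log y} cos(t v)/v dv`
(`1 < x ≤ y`). [folklore] -/
theorem integral_cos_log_mul_weight_eq (t : ℝ) {x y : ℝ} (hx : 1 < x) (hxy : x ≤ y) :
    ∫ u in x..y, Real.cos (t * Real.log u) * weight u =
      ∫ v in Real.log x..Real.log y, Real.cos (t * v) / v := by
  have hmem : ∀ u ∈ uIcc x y, 1 < u := fun u hu => by
    rw [uIcc_of_le hxy] at hu; exact hx.trans_le hu.1
  have h1 : ∀ u ∈ uIcc x y, HasDerivAt Real.log u⁻¹ u := fun u hu =>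
    Real.hasDerivAt_log (by linarith [hmem u hu])
  have h2 : ContinuousOn (fun u : ℝ => u⁻¹) (uIcc x y) :=
    continuousOn_inv₀.mono fun u hu => by
      have := hmem u hu
      rw [mem_compl_iff, mem_singleton_iff]; linarith
  have h3 : ContinuousOn (fun v : ℝ => Real.cos (t * v) / v) (Real.log '' uIcc x y) := by
    rintro v ⟨u, hu, rfl⟩
    have hpos : 0 < Real.log u := Real.log_pos (hmem u hu)
    exact (((Real.continuous_cos.comp (continuous_const.mul continuous_id)).continuousAt).div
      continuousAt_id hpos.ne').continuousWithinAt
  have hsub := intervalIntegral.integral_comp_mul_deriv' h1 h2 h3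
  rw [← hsub]
  refine intervalIntegral.integral_congr fun u hu => ?_
  have hu1 : 1 < u := hmem u hu
  have hu0 : u ≠ 0 := by linarith
  have hlog : Real.log u ≠ 0 := (Real.log_pos hu1).ne'
  simp only [Function.comp_apply, weight, mul_inv]
  field_simp

/-- Hence `∫_x^y cos(t log u)/(u log u) du ≥ -3` for `1 < x ≤ y`. [folklore] -/
theorem integral_cos_log_mul_weight_ge (t : ℝ) {x y : ℝ} (hx : 1 < x) (hxy : x ≤ y) :
    -3 ≤ ∫ u in x..y, Real.cos (t * Real.log u) * weight u := by
  rw [integral_cos_log_mul_weight_eq t hx hxy]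
  exact integral_cos_mul_div_ge t (Real.log_pos hx) (Real.log_le_log (by linarith) hxy)

/-- `Re u^{it} = cos(t log u)` for `u > 0`. [folklore] -/
theorem re_ofReal_cpow_mul_I {u : ℝ} (hu : 0 < u) (t : ℝ) :
    ((u : ℂ) ^ ((t : ℂ) * I)).re = Real.cos (t * Real.log u) := by
  rw [Complex.cpow_def_of_ne_zero (by exact_mod_cast hu.ne'), ← Complex.ofReal_log hu.le]
  have : (Real.log u : ℂ) * ((t : ℂ) * I) = ((t * Real.log u : ℝ) : ℂ) * I := by push_cast; ring
  rw [this, Complex.exp_ofReal_mul_I_re]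

/-- `u ↦ u^r` (`u` real, `r` complex) is continuous on `[x, y]` for `x > 0`. [folklore] -/
theorem continuousOn_ofReal_cpow_const {x y : ℝ} (hx : 0 < x) (hxy : x ≤ y) (r : ℂ) :
    ContinuousOn (fun u : ℝ => (u : ℂ) ^ r) (uIcc x y) := fun u hu => by
  rw [uIcc_of_le hxy] at hu
  exact (Complex.continuousAt_ofReal_cpow_const u r (Or.inr (hx.trans_le hu.1).ne')).continuousWithinAt

/-- **The main term has real part `≥ -3`**: for `1 < x ≤ y` and real `t`,
`Re ∫_x^y u^{-it}/(u log u) du = ∫_{log x}^{log y} cos(t v)/v dv ≥ -3`. [folklore] -/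
theorem re_integral_weight_mul_cpow_ge (t : ℝ) {x y : ℝ} (hx : 1 < x) (hxy : x ≤ y) :
    -3 ≤ (∫ u in x..y, ((weight u : ℝ) : ℂ) * (u : ℂ) ^ (-((t : ℂ) * I))).re := by
  have hx0 : 0 < x := by linarith
  have hint : IntervalIntegrable (fun u : ℝ => ((weight u : ℝ) : ℂ) * (u : ℂ) ^ (-((t : ℂ) * I)))
      volume x y := by
    refine ContinuousOn.intervalIntegrable ?_
    refine ContinuousOn.mul ?_ (continuousOn_ofReal_cpow_const hx0 hxy _)
    refine Complex.continuous_ofReal.comp_continuousOn ?_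
    have hmem : ∀ u ∈ uIcc x y, 1 < u := fun u hu => by
      rw [uIcc_of_le hxy] at hu; exact hx.trans_le hu.1
    refine ContinuousOn.inv₀ (continuousOn_id.mul (Real.continuousOn_log.mono fun u hu => ?_))
      fun u hu => ?_
    · simp only [mem_compl_iff, mem_singleton_iff]; linarith [hmem u hu]
    · exact mul_ne_zero (by linarith [hmem u hu]) (Real.log_pos (hmem u hu)).ne'
  have hre := intervalIntegral.intervalIntegral_re hint
  simp only [RCLike.re_to_complex] at hre
  rw [← hre]
  have heq : ∫ u in x..y, (((weight u : ℝ) : ℂ) * (u : ℂ) ^ (-((t : ℂ) * I))).re =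
      ∫ u in x..y, Real.cos (t * Real.log u) * weight u := by
    refine intervalIntegral.integral_congr fun u hu => ?_
    have hu0 : 0 < u := by
      rw [uIcc_of_le hxy] at hu; linarith [hu.1]
    have e : -((t : ℂ) * I) = ((-t : ℝ) : ℂ) * I := by push_cast; ring
    rw [Complex.re_ofReal_mul, e, re_ofReal_cpow_mul_I hu0, neg_mul, Real.cos_neg, mul_comm]
  rw [heq]
  exact integral_cos_log_mul_weight_ge t hx hxy

/-! ### The twisted prime sums over the Vinogradov–Korobov window -/

variable {q : ℕ} [NeZero q]

/-- **The prime sums minus their main term**: if `‖U(u) − δ u^a/a‖ ≤ εu` and `ψ(u) − ϑ(u) ≤ εu` then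
`‖D(u) − δ u^a/a‖ ≤ 2εu` (`D(u) = ∑_{p ≤ u} χ(p) log p · p^{-it}`, `a = 1 − it`).
[cite: Lichtman2020, Lemma 4.5 (proof)] -/
theorem norm_sum_primeCoeff_sub_le (χ : DirichletCharacter ℂ q) (t : ℝ) {u ε : ℝ}
    (htw : ‖∑ k ∈ Finset.Ioc 0 ⌊u⌋₊, twist χ t k -
      delta χ * (u : ℂ) ^ (1 - t * I) / (1 - t * I)‖ ≤ ε * u)
    (hψθ : Chebyshev.psi u - Chebyshev.theta u ≤ ε * u) :
    ‖∑ k ∈ Finset.Icc 0 ⌊u⌋₊, primeCoeff χ t k -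
        delta χ * (u : ℂ) ^ (1 - t * I) / (1 - t * I)‖ ≤ 2 * ε * u := by
  have h0 : ∑ k ∈ Finset.Icc 0 ⌊u⌋₊, primeCoeff χ t k = ∑ k ∈ Finset.Ioc 0 ⌊u⌋₊, primeCoeff χ t k := by
    rw [← Finset.Ioc_insert_left (Nat.zero_le _), Finset.sum_insert (by simp),
      primeCoeff_of_not_prime χ t Nat.not_prime_zero, zero_add]
  rw [h0]
  set U : ℂ := ∑ k ∈ Finset.Ioc 0 ⌊u⌋₊, twist χ t k with hU
  set D : ℂ := ∑ k ∈ Finset.Ioc 0 ⌊u⌋₊, primeCoeff χ t k with hD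
  set M : ℂ := delta χ * (u : ℂ) ^ (1 - t * I) / (1 - t * I) with hM
  have hdiff := norm_sum_twist_sub_sum_primeCoeff_le χ t u
  rw [← hU, ← hD] at hdiff
  calc ‖D - M‖ = ‖(U - M) - (U - D)‖ := by ring_nf
    _ ≤ ‖U - M‖ + ‖U - D‖ := norm_sub_le _ _
    _ ≤ ε * u + ε * u := add_le_add htw (hdiff.trans hψθ)
    _ = 2 * ε * u := by ring

set_option maxHeartbeats 1600000 in
/-- **The real part of the prime character sum over the Vinogradov–Korobov window is bounded
below.**  Assume a Vinogradov–Korobov region `HasVKZeroFreeRegion c T₀` (`c > 0`).  For `A > 0`,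
`θ > 2/3`: for all large `X`, all `q ≤ (log X)^A`,
all `χ` mod `q` and all `|t| ≤ X`,
`Re ∑_{exp((log X)^θ) ≤ p ≤ X} χ(p) p^{-1-it} ≥ -4`.
Abel summation with `f(u) = 1/(u log u)` against `D(u) = ∑_{p ≤ u} χ(p) log p · p^{-it}
= δ_χ u^{1-it}/(1-it) + O(u (log X)^{-2})` (`TwistedVonMangoldt.twisted_sum_estimate_of_vk`,
`ψ − ϑ ≤ 2√u log u`);
the main term integrates by parts back to `δ_χ ∫ u^{-it}/(u log u) du = δ_χ ∫ cos(t v)/v dv + i(…)`,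
whose real part is `≥ -3`, and the error terms total `≤ 4/log X + 4/(log X)² ≤ 1`.
[cite: MatomakiRadziwillTao2015, §1 (1.12) (display following Theorem 1.6)]
[cite: Khale2024, (1.4)] -/
theorem re_primeCharSum_ge_of_vk {c T₀ : ℝ} (hc : 0 < c) (hVK : HasVKZeroFreeRegion c T₀)
    {A θ : ℝ} (hA : 0 < A) (hθ : 2 / 3 < θ) :
    ∀ᶠ X : ℝ in atTop, ∀ (q : ℕ) [NeZero q], (q : ℝ) ≤ Real.log X ^ A →
      ∀ (χ : DirichletCharacter ℂ q) (t : ℝ), |t| ≤ X →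
        -4 ≤ (∑ p ∈ (Finset.Icc ⌈Real.exp (Real.log X ^ θ)⌉₊ ⌊X⌋₊).filter Nat.Prime,
            χ (p : ZMod q) * (p : ℂ) ^ (-(1 + (t : ℂ) * I))).re := by
  have hθ0 : 0 < θ := by linarith
  filter_upwards [twisted_sum_estimate_of_vk hc hVK hA hθ (K := 2) (by norm_num),
    Real.tendsto_log_atTop.eventually_ge_atTop (16 : ℝ),
    ((tendsto_rpow_atTop hθ0).comp Real.tendsto_log_atTop).eventually_ge_atTop (4 : ℝ),
    eventually_mul_log_rpow_le_exp 16 2 (show (0 : ℝ) < 1 / 4 by norm_num) hθ0,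
    eventually_gt_atTop (0 : ℝ)] with X htw hℓ16 hℓθ hEψ hX0
  intro q _ hqA χ t ht
  set ℓ : ℝ := Real.log X with hℓdef
  have hℓ1 : 1 ≤ ℓ := by linarith
  have hℓ0 : 0 < ℓ := by linarith
  have hℓθ' : (4 : ℝ) ≤ ℓ ^ θ := by simpa using hℓθ
  set P : ℝ := Real.exp (ℓ ^ θ) with hPdef
  have hP0 : 0 < P := Real.exp_pos _
  -- the empty range
  rcases lt_or_ge X P with hXP | hPX
  · have hempty : (Finset.Icc ⌈P⌉₊ ⌊X⌋₊).filter Nat.Prime = ∅ := by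
      have hlt : ⌊X⌋₊ < ⌈P⌉₊ := by
        have h1 : (⌊X⌋₊ : ℝ) ≤ X := Nat.floor_le hX0.le
        have h2 : P ≤ ⌈P⌉₊ := Nat.le_ceil P
        exact_mod_cast (show (⌊X⌋₊ : ℝ) < ⌈P⌉₊ by linarith)
      rw [Finset.Icc_eq_empty_of_lt hlt, Finset.filter_empty]
    rw [hempty, Finset.sum_empty, Complex.zero_re]
    norm_num
  -- parameters
  set ε : ℝ := ℓ ^ (-(2 : ℝ)) with hεdef
  have hε0 : 0 < ε := Real.rpow_pos_of_pos hℓ0 _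
  have hεval : ε = (ℓ ^ 2)⁻¹ := by
    rw [hεdef, Real.rpow_neg hℓ0.le, Real.rpow_two]
  have hεψ : 16 * Real.exp (-(ℓ ^ θ / 4)) ≤ ε := by
    have hprod : ℓ ^ (2 : ℝ) * ε = 1 := by
      rw [hεdef, ← Real.rpow_add hℓ0, add_neg_cancel, Real.rpow_zero]
    have h1 := mul_le_mul_of_nonneg_right hEψ (show 0 ≤ Real.exp (-(ℓ ^ θ / 4)) * ε by positivity)
    have h2 : 16 * ℓ ^ (2 : ℝ) * (Real.exp (-(ℓ ^ θ / 4)) * ε) =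
        16 * Real.exp (-(ℓ ^ θ / 4)) * (ℓ ^ (2 : ℝ) * ε) := by ring
    have h3 : Real.exp (1 / 4 * ℓ ^ θ) * (Real.exp (-(ℓ ^ θ / 4)) * ε) = ε := by
      rw [← mul_assoc, ← Real.exp_add, show 1 / 4 * ℓ ^ θ + -(ℓ ^ θ / 4) = 0 by ring, Real.exp_zero,
        one_mul]
    rw [h2, hprod, mul_one, h3] at h1
    exact h1
  -- `P`, `n`, `m`
  have he4 : (5 : ℝ) ≤ Real.exp 4 := by have := Real.add_one_le_exp (4 : ℝ); linarith
  have hexpP : Real.exp 4 ≤ P := Real.exp_le_exp.2 hℓθ'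
  have hP5 : 5 ≤ P := he4.trans hexpP
  rw [sum_primes_eq_sum_weight_mul χ t hP0 X]
  set n : ℕ := ⌈P⌉₊ - 1 with hndef
  set m : ℕ := ⌊X⌋₊ with hmdef
  have hn1 : 1 ≤ ⌈P⌉₊ := Nat.ceil_pos.2 hP0
  have hncast : (n : ℝ) = ⌈P⌉₊ - 1 := by rw [hndef, Nat.cast_sub hn1, Nat.cast_one]
  have hnP : P - 1 ≤ n := by rw [hncast]; linarith [Nat.le_ceil P]
  have hn_ge : Real.exp (ℓ ^ θ) / 2 ≤ n := by rw [← hPdef]; linarith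
  have hn2 : (2 : ℝ) ≤ n := by linarith
  have hn0 : (0 : ℝ) < n := by linarith
  have hn1' : (1 : ℝ) < n := by linarith
  have hmX : (m : ℝ) ≤ X := Nat.floor_le hX0.le
  have hnm : n ≤ m := by
    have h1 : (⌈P⌉₊ : ℝ) < P + 1 := Nat.ceil_lt_add_one hP0.le
    have h2 : X < (⌊X⌋₊ : ℝ) + 1 := Nat.lt_floor_add_one X
    have h3 : (⌈P⌉₊ : ℝ) < (⌊X⌋₊ : ℝ) + 2 := by linarith
    have h4 : ⌈P⌉₊ < ⌊X⌋₊ + 2 := by exact_mod_cast h3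
    omega
  have hnmR : (n : ℝ) ≤ m := by exact_mod_cast hnm
  have hm0 : (0 : ℝ) < m := by linarith
  -- logarithms
  have hlog2 : Real.log 2 ≤ 1 := by
    have := Real.log_le_sub_one_of_pos (show (0 : ℝ) < 2 by norm_num); linarith
  have hlogn : ℓ ^ θ / 2 ≤ Real.log n := by
    have h1 : Real.log (Real.exp (ℓ ^ θ) / 2) = ℓ ^ θ - Real.log 2 := by
      rw [Real.log_div (Real.exp_pos _).ne' (by norm_num), Real.log_exp]
    have h2 : Real.log (Real.exp (ℓ ^ θ) / 2) ≤ Real.log n := Real.log_le_log (by positivity) hn_ge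
    linarith
  have hlogn1 : 1 ≤ Real.log n := by linarith
  have hlogn0 : 0 < Real.log n := by linarith
  have hlogm : Real.log n ≤ Real.log m := Real.log_le_log hn0 hnmR
  have hlogm0 : 0 < Real.log m := by linarith
  have hlogmn : Real.log ((m : ℝ) / n) ≤ ℓ := by
    have h1 : (m : ℝ) / n ≤ X := by
      rw [div_le_iff₀ hn0]
      calc (m : ℝ) ≤ X := hmX
        _ = X * 1 := (mul_one X).symm
        _ ≤ X * n := mul_le_mul_of_nonneg_left hn1'.le hX0.le
    exact Real.log_le_log (by positivity) h1
  -- the main term `M(u) = δ u^{r+1}/(r+1)`, `r = -it`, and its derivative `M'(u) = δ u^r`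
  set r : ℂ := -((t : ℂ) * I) with hrdef
  have hr1 : r + 1 = 1 - t * I := by rw [hrdef]; ring
  have hrne : r ≠ -1 := by
    intro h
    have := congrArg Complex.re h
    simp [hrdef] at this
  set M : ℝ → ℂ := fun u => delta χ * ((u : ℂ) ^ (r + 1) / (r + 1)) with hMdef
  set M' : ℝ → ℂ := fun u => delta χ * (u : ℂ) ^ r with hM'def
  have hMderiv : ∀ u ∈ uIcc (n : ℝ) m, HasDerivAt M (M' u) u := by
    intro u hu
    rw [uIcc_of_le hnmR] at hu
    have hu0 : u ≠ 0 := by linarith [hu.1]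
    exact (hasDerivAt_ofReal_cpow_const' hu0 hrne).const_mul (delta χ)
  have hMeq : ∀ u : ℝ, M u = delta χ * (u : ℂ) ^ (1 - t * I) / (1 - t * I) := by
    intro u
    simp only [hMdef, hr1, mul_div_assoc]
  -- `‖D(u) − M(u)‖ ≤ 2εu` on `[n, m]`
  have hDM : ∀ u : ℝ, (n : ℝ) ≤ u → u ≤ m →
      ‖∑ k ∈ Finset.Icc 0 ⌊u⌋₊, primeCoeff χ t k - M u‖ ≤ 2 * ε * u := by
    intro u hu1 hu2
    have hulo : Real.exp (ℓ ^ θ) / 2 ≤ u := hn_ge.trans hu1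
    have huX : u ≤ X := hu2.trans hmX
    rw [hMeq]
    exact norm_sum_primeCoeff_sub_le χ t (htw q hqA χ t ht u hulo huX)
      (psi_sub_theta_le_of_scale hℓθ' hεψ hulo)
  -- Abel summation
  have hf_diff : ∀ u ∈ Set.Icc (n : ℝ) m, DifferentiableAt ℝ (fun u : ℝ ↦ ((weight u : ℝ) : ℂ)) u :=
    fun u hu ↦ (hasDerivAt_weightC (by linarith [hu.1] : 1 < u)).differentiableAt
  have hderiv : ∀ u ∈ Set.Icc (n : ℝ) m, deriv (fun u : ℝ ↦ ((weight u : ℝ) : ℂ)) u =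
      (((-(Real.log u + 1) / (u * Real.log u) ^ 2 : ℝ)) : ℂ) :=
    fun u hu ↦ (hasDerivAt_weightC (by linarith [hu.1] : 1 < u)).deriv
  have hcontR : ContinuousOn (fun u : ℝ ↦ -(Real.log u + 1) / (u * Real.log u) ^ 2) (Set.Icc (n : ℝ) m) := by
    have hlogc : ContinuousOn Real.log (Set.Icc (n : ℝ) m) :=
      Real.continuousOn_log.mono fun u hu ↦ by
        simp only [Set.mem_compl_iff, Set.mem_singleton_iff]
        exact (by linarith [hu.1] : (0 : ℝ) < u).ne'
    refine ContinuousOn.div ((hlogc.add continuousOn_const).neg) ((continuousOn_id.mul hlogc).pow 2) ?_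
    intro u hu
    have hu1 : 1 < u := by linarith [hu.1]
    exact pow_ne_zero 2 (mul_ne_zero (by linarith) (Real.log_pos hu1).ne')
  have hcontC : ContinuousOn (fun u : ℝ ↦ (((-(Real.log u + 1) / (u * Real.log u) ^ 2 : ℝ)) : ℂ))
      (Set.Icc (n : ℝ) m) := Complex.continuous_ofReal.comp_continuousOn hcontR
  have hf_int : IntegrableOn (deriv (fun u : ℝ ↦ ((weight u : ℝ) : ℂ))) (Set.Icc (n : ℝ) m) :=
    (hcontC.integrableOn_Icc).congr_fun (fun u hu ↦ (hderiv u hu).symm) measurableSet_Icc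
  have hAbel : ∑ k ∈ Finset.Ioc n m, ((weight k : ℝ) : ℂ) * primeCoeff χ t k =
      ((weight m : ℝ) : ℂ) * (∑ k ∈ Finset.Icc 0 m, primeCoeff χ t k) -
        ((weight n : ℝ) : ℂ) * (∑ k ∈ Finset.Icc 0 n, primeCoeff χ t k) -
        ∫ u in Set.Ioc (n : ℝ) m, deriv (fun u : ℝ ↦ ((weight u : ℝ) : ℂ)) u *
          ∑ k ∈ Finset.Icc 0 ⌊u⌋₊, primeCoeff χ t k :=
    sum_mul_eq_sub_sub_integral_mul' (primeCoeff χ t) hnm hf_diff hf_int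
  -- the Abel integral as an interval integral of `w' · D`
  set w' : ℝ → ℂ := fun u ↦ (((-(Real.log u + 1) / (u * Real.log u) ^ 2 : ℝ)) : ℂ) with hw'def
  set D : ℝ → ℂ := fun u ↦ ∑ k ∈ Finset.Icc 0 ⌊u⌋₊, primeCoeff χ t k with hDdef
  have hIoc : ∫ u in Set.Ioc (n : ℝ) m, deriv (fun u : ℝ ↦ ((weight u : ℝ) : ℂ)) u *
      ∑ k ∈ Finset.Icc 0 ⌊u⌋₊, primeCoeff χ t k = ∫ u in (n : ℝ)..m, w' u * D u := by
    rw [intervalIntegral.integral_of_le hnmR]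
    refine setIntegral_congr_fun measurableSet_Ioc fun u hu => ?_
    simp only [hw'def, hDdef]
    rw [hderiv u ⟨hu.1.le, hu.2⟩]
  -- integrability of `w' · D` and `w' · M`, `M'`
  have hwD_int : IntervalIntegrable (fun u => w' u * D u) volume n m := by
    rw [intervalIntegrable_iff_integrableOn_Icc_of_le hnmR]
    exact integrableOn_mul_sum_Icc (primeCoeff χ t) (Nat.cast_nonneg n) hcontC.integrableOn_Icc
  have hMcont : ContinuousOn M (uIcc (n : ℝ) m) :=
    continuousOn_const.mul ((continuousOn_ofReal_cpow_const hn0 hnmR (r + 1)).div_const (r + 1))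
  have hM'cont : ContinuousOn M' (uIcc (n : ℝ) m) :=
    continuousOn_const.mul (continuousOn_ofReal_cpow_const hn0 hnmR r)
  have hw'cont : ContinuousOn w' (uIcc (n : ℝ) m) := by rw [uIcc_of_le hnmR]; exact hcontC
  have hwM_int : IntervalIntegrable (fun u => w' u * M u) volume n m :=
    (hw'cont.mul hMcont).intervalIntegrable
  have hw'_int : IntervalIntegrable w' volume n m := hw'cont.intervalIntegrable
  have hM'_int : IntervalIntegrable M' volume n m := hM'cont.intervalIntegrable
  -- integration by parts for the main term
  have hwderiv : ∀ u ∈ uIcc (n : ℝ) m, HasDerivAt (fun u : ℝ ↦ ((weight u : ℝ) : ℂ)) (w' u) u := by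
    intro u hu
    rw [uIcc_of_le hnmR] at hu
    exact hasDerivAt_weightC (by linarith [hu.1] : 1 < u)
  have hIBP : ∫ u in (n : ℝ)..m, ((weight u : ℝ) : ℂ) * M' u =
      ((weight m : ℝ) : ℂ) * M m - ((weight n : ℝ) : ℂ) * M n -
        ∫ u in (n : ℝ)..m, w' u * M u :=
    intervalIntegral.integral_mul_deriv_eq_deriv_mul hwderiv hMderiv hw'_int hM'_int
  -- the decomposition `S = Main + Err`
  set Main : ℂ := ∫ u in (n : ℝ)..m, ((weight u : ℝ) : ℂ) * M' u with hMain
  set Err : ℂ := ((weight m : ℝ) : ℂ) * (D m - M m) - ((weight n : ℝ) : ℂ) * (D n - M n) -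
      ∫ u in (n : ℝ)..m, w' u * (D u - M u) with hErr
  have hsub_int : ∫ u in (n : ℝ)..m, w' u * (D u - M u) =
      (∫ u in (n : ℝ)..m, w' u * D u) - ∫ u in (n : ℝ)..m, w' u * M u := by
    rw [← intervalIntegral.integral_sub hwD_int hwM_int]
    refine intervalIntegral.integral_congr fun u _ => ?_
    simp only [mul_sub]
  have hDm : D m = ∑ k ∈ Finset.Icc 0 m, primeCoeff χ t k := by
    simp only [hDdef, Nat.floor_natCast]
  have hDn : D n = ∑ k ∈ Finset.Icc 0 n, primeCoeff χ t k := by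
    simp only [hDdef, Nat.floor_natCast]
  have hdecomp : ∑ k ∈ Finset.Ioc n m, ((weight k : ℝ) : ℂ) * primeCoeff χ t k = Main + Err := by
    rw [hAbel, hIoc, hIBP, hErr, hsub_int, hDm, hDn]
    ring
  -- size of the error
  have hDMm : ‖D m - M m‖ ≤ 2 * ε * m := by
    rw [hDm]; have := hDM m hnmR le_rfl; rwa [Nat.floor_natCast] at this
  have hDMn : ‖D n - M n‖ ≤ 2 * ε * n := by
    rw [hDn]; have := hDM n le_rfl hnmR; rwa [Nat.floor_natCast] at this
  have hwm : ‖((weight m : ℝ) : ℂ) * (D m - M m)‖ ≤ 2 * ε := by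
    rw [norm_mul, Complex.norm_real, Real.norm_eq_abs, weight, abs_of_pos (by positivity)]
    calc ((m : ℝ) * Real.log m)⁻¹ * ‖D m - M m‖
        ≤ ((m : ℝ) * Real.log m)⁻¹ * (2 * ε * m) := mul_le_mul_of_nonneg_left hDMm (by positivity)
      _ = 2 * ε / Real.log m := by field_simp
      _ ≤ 2 * ε / 1 := div_le_div_of_nonneg_left (by positivity) one_pos (hlogn1.trans hlogm)
      _ = 2 * ε := div_one _
  have hwn : ‖((weight n : ℝ) : ℂ) * (D n - M n)‖ ≤ 2 * ε := by
    rw [norm_mul, Complex.norm_real, Real.norm_eq_abs, weight, abs_of_pos (by positivity)]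
    calc ((n : ℝ) * Real.log n)⁻¹ * ‖D n - M n‖
        ≤ ((n : ℝ) * Real.log n)⁻¹ * (2 * ε * n) := mul_le_mul_of_nonneg_left hDMn (by positivity)
      _ = 2 * ε / Real.log n := by field_simp
      _ ≤ 2 * ε / 1 := div_le_div_of_nonneg_left (by positivity) one_pos hlogn1
      _ = 2 * ε := div_one _
  set g : ℝ → ℝ := fun u ↦ 4 * ε / Real.log n * u⁻¹ with hgdef
  have hgcont : ContinuousOn g (Set.Icc (n : ℝ) m) := by
    refine ContinuousOn.mul continuousOn_const (continuousOn_inv₀.comp continuousOn_id fun u hu ↦ ?_)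
    exact (by linarith [hu.1] : (0 : ℝ) < u).ne'
  have hgi : IntervalIntegrable g volume n m := by
    rw [intervalIntegrable_iff_integrableOn_Icc_of_le hnmR]; exact hgcont.integrableOn_Icc
  have hbound : ∀ᵐ u : ℝ ∂volume, u ∈ Set.Ioc (n : ℝ) m → ‖w' u * (D u - M u)‖ ≤ g u := by
    refine ae_of_all _ fun u hu ↦ ?_
    have hu1 : (n : ℝ) < u := hu.1
    have hu2 : u ≤ m := hu.2
    have hu0 : 0 < u := by linarith
    have hlogu : Real.log n ≤ Real.log u := Real.log_le_log hn0 hu1.le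
    have hlogu1 : 1 ≤ Real.log u := hlogn1.trans hlogu
    rw [norm_mul]
    have h1 := norm_deriv_weight_le (by linarith : 1 < u) hlogu1
    have h2 := hDM u hu1.le hu2
    calc ‖w' u‖ * ‖D u - M u‖ ≤ 2 / (u ^ 2 * Real.log u) * (2 * ε * u) :=
          mul_le_mul h1 h2 (norm_nonneg _) (by positivity)
      _ = 4 * ε / Real.log u * u⁻¹ := by field_simp; ring
      _ ≤ 4 * ε / Real.log n * u⁻¹ := by gcongr
      _ = g u := rfl
  have hint : ‖∫ u in (n : ℝ)..m, w' u * (D u - M u)‖ ≤ 4 * ε * ℓ := by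
    refine (intervalIntegral.norm_integral_le_of_norm_le hnmR hbound hgi).trans ?_
    rw [hgdef, intervalIntegral.integral_const_mul, integral_inv_of_pos hn0 hm0]
    calc 4 * ε / Real.log n * Real.log ((m : ℝ) / n) ≤ 4 * ε / Real.log n * ℓ :=
          mul_le_mul_of_nonneg_left hlogmn (by positivity)
      _ ≤ 4 * ε / 1 * ℓ := by gcongr
      _ = 4 * ε * ℓ := by rw [div_one]
  have hErr_le : ‖Err‖ ≤ 1 := by
    have h1 : ‖Err‖ ≤ 2 * ε + 2 * ε + 4 * ε * ℓ := by
      calc ‖Err‖ ≤ ‖((weight m : ℝ) : ℂ) * (D m - M m) - ((weight n : ℝ) : ℂ) * (D n - M n)‖ +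
            ‖∫ u in (n : ℝ)..m, w' u * (D u - M u)‖ := norm_sub_le _ _
        _ ≤ (‖((weight m : ℝ) : ℂ) * (D m - M m)‖ + ‖((weight n : ℝ) : ℂ) * (D n - M n)‖) +
            ‖∫ u in (n : ℝ)..m, w' u * (D u - M u)‖ := by gcongr; exact norm_sub_le _ _
        _ ≤ (2 * ε + 2 * ε) + 4 * ε * ℓ := add_le_add (add_le_add hwm hwn) hint
    -- `ε = ℓ^{-2}`, `ℓ ≥ 16`
    have h2 : 4 * ε + 4 * ε * ℓ ≤ 1 := by
      rw [hεval]
      have hℓ2 : 0 < ℓ ^ 2 := by positivity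
      rw [show 4 * (ℓ ^ 2)⁻¹ + 4 * (ℓ ^ 2)⁻¹ * ℓ = (4 + 4 * ℓ) / ℓ ^ 2 by field_simp,
        div_le_one hℓ2]
      nlinarith
    linarith
  -- the real part of the main term
  have hMain_re : -3 ≤ Main.re := by
    by_cases hχ : χ = 1
    · have hδ : delta χ = 1 := by simp [delta, hχ]
      have h := re_integral_weight_mul_cpow_ge t hn1' hnmR
      have e : Main = ∫ u in (n : ℝ)..m, ((weight u : ℝ) : ℂ) * (u : ℂ) ^ (-((t : ℂ) * I)) := by
        simp only [hMain, hM'def, hδ, one_mul, hrdef]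
      rw [e]; exact h
    · have hδ : delta χ = 0 := by simp [delta, hχ]
      have e : Main = 0 := by
        simp only [hMain, hM'def, hδ, zero_mul, mul_zero, intervalIntegral.integral_zero]
      rw [e, Complex.zero_re]; norm_num
  -- conclusion
  rw [hdecomp, Complex.add_re]
  have hErr_re : -1 ≤ Err.re := by
    have := (Complex.abs_re_le_norm Err).trans hErr_le
    exact (abs_le.1 this).1
  linarith

/-- The index set of MRT (1.12): `{p ≤ ⌊X⌋ prime : y ≤ p} = {p prime : ⌈y⌉ ≤ p ≤ ⌊X⌋}`. [folklore] -/
theorem primesLE_filter_eq (X y : ℝ) :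
    (Nat.primesLE ⌊X⌋₊).filter (fun p : ℕ => y ≤ p) = (Finset.Icc ⌈y⌉₊ ⌊X⌋₊).filter Nat.Prime := by
  ext p
  simp only [Finset.mem_filter, Nat.mem_primesLE, Finset.mem_Icc, Nat.ceil_le]
  tauto

omit [NeZero q] in
/-- The summand of MRT (1.12) against Lichtman's form: for a prime `p`,
`Re(χ(p) p^{-(1 + i(-t))}) = Re(χ(p) p^{it})/p`. [folklore] -/
theorem re_term_eq (χ : DirichletCharacter ℂ q) (t : ℝ) {p : ℕ} (hp : p.Prime) :
    (χ (p : ZMod q) * (p : ℂ) ^ (-(1 + ((-t : ℝ) : ℂ) * I))).re =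
      (1 : ℝ) / p * (χ (p : ZMod q) * (p : ℂ) ^ ((t : ℂ) * I)).re := by
  have hp0 : (p : ℂ) ≠ 0 := by exact_mod_cast hp.ne_zero
  have e : -(1 + ((-t : ℝ) : ℂ) * I) = (-1 : ℂ) + (t : ℂ) * I := by push_cast; ring
  rw [e, Complex.cpow_add _ _ hp0, Complex.cpow_neg_one]
  have e2 : χ (p : ZMod q) * ((p : ℂ)⁻¹ * (p : ℂ) ^ ((t : ℂ) * I)) =
      (((1 : ℝ) / p : ℝ) : ℂ) * (χ (p : ZMod q) * (p : ℂ) ^ ((t : ℂ) * I)) := by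
    push_cast; ring
  rw [e2, Complex.re_ofReal_mul]

/-- **The twisted prime sums over the Vinogradov–Korobov range** (Khale's form of
`re_primeCharSum_ge_of_vk`).  Assume Khale's theorem.  For `A > 0`, `θ > 2/3`: for all large `X`, all
`q ≤ (log X)^A`, all `χ` mod `q` and all `|t| ≤ X`, `Re ∑_{exp((log X)^θ) ≤ p ≤ X} χ(p) p^{-1-it} ≥ -4`.
[cite: MatomakiRadziwillTao2015, §1 (1.12) (display following Theorem 1.6)]
[cite: Khale2024, Theorem 1.1] -/
theorem re_primeCharSum_ge (hK : Khale2024_zeroFreeRegion) {A θ : ℝ} (hA : 0 < A)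
    (hθ : 2 / 3 < θ) :
    ∀ᶠ X : ℝ in atTop, ∀ (q : ℕ) [NeZero q], (q : ℝ) ≤ Real.log X ^ A →
      ∀ (χ : DirichletCharacter ℂ q) (t : ℝ), |t| ≤ X →
        -4 ≤ (∑ p ∈ (Finset.Icc ⌈Real.exp (Real.log X ^ θ)⌉₊ ⌊X⌋₊).filter Nat.Prime,
            χ (p : ZMod q) * (p : ℂ) ^ (-(1 + (t : ℂ) * I))).re :=
  re_primeCharSum_ge_of_vk (by norm_num) (hasVKZeroFreeRegion_of_khale hK) hA hθ

end MRT2015DistLowerBound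

open MRT2015DistLowerBound in
/-- **Matomäki–Radziwiłł–Tao 2015, (1.12), from any Vinogradov–Korobov zero-free region for
Dirichlet `L`-functions** `HasVKZeroFreeRegion c T₀` (`c > 0`; the inexplicit printed shape, Khale (1.4)
= Montgomery, *Ten lectures*, p. 176).  For every `ε > 0` there are `C, X₀` with
`∑_{exp((log X)^{2/3+ε}) ≤ p ≤ X} (1 + Re χ(p)p^{it})/p ≥ (1/3 − ε) log log X − C` for `X ≥ X₀`,
`1 ≤ q ≤ (log X)^{1/125}`, `χ` mod `q`, `|t| ≤ X`: the `1`'s contribute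
`≥ log log X − log log y − 6/log y = (1/3 − ε) log log X − O(1)` (Mertens, `MertensBound.loglog_sub_loglog_le_sum_inv_prime_Icc`,
`y = exp((log X)^{2/3+ε})`), and `Re ∑ χ(p)p^{it}/p ≥ −4` over the same range
(`MRT2015DistLowerBound.re_primeCharSum_ge`, the "standard methods from the Vinogradov–Korobov type
zero-free region" of the source).  This discharges the named fact
`MatomakiRadziwillTao2015_liouvilleDistLowerBound` conditionally on the zero-free region, the one
printed input of this circle of results not proved in the tree.
[cite: MatomakiRadziwillTao2015, §1 (1.12) (display following Theorem 1.6)]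
[cite: Khale2024, (1.4)] -/
theorem MatomakiRadziwillTao2015_liouvilleDistLowerBound_of_vk {c T₀ : ℝ} (hc : 0 < c)
    (hVK : HasVKZeroFreeRegion c T₀) : MatomakiRadziwillTao2015_liouvilleDistLowerBound := by
  intro ε hε
  set θ : ℝ := 2 / 3 + ε with hθdef
  have hθ : 2 / 3 < θ := by rw [hθdef]; linarith
  have hθ0 : 0 < θ := by linarith
  have hA : (0 : ℝ) < 1 / 125 := by norm_num
  obtain ⟨X₀, hX₀⟩ := Filter.eventually_atTop.1 (re_primeCharSum_ge_of_vk hc hVK hA hθ)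
  refine ⟨10, max X₀ (Real.exp (Real.exp 4)), fun X hX q χ t hq hqX ht => ?_⟩
  have hXX₀ : X₀ ≤ X := (le_max_left _ _).trans hX
  have hXe : Real.exp (Real.exp 4) ≤ X := (le_max_right _ _).trans hX
  have hX0 : 0 < X := (Real.exp_pos _).trans_le hXe
  set ℓ : ℝ := Real.log X with hℓdef
  have he4 : (5 : ℝ) ≤ Real.exp 4 := by have := Real.add_one_le_exp (4 : ℝ); linarith
  have hℓe : Real.exp 4 ≤ ℓ := by
    have := Real.log_le_log (Real.exp_pos _) hXe
    rwa [Real.log_exp] at this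
  have hℓ1 : 1 ≤ ℓ := by linarith
  have hℓ0 : 0 < ℓ := by linarith
  have hlogℓ : 0 ≤ Real.log ℓ := Real.log_nonneg hℓ1
  haveI : NeZero q := ⟨Nat.one_le_iff_ne_zero.mp hq⟩
  set y : ℝ := Real.exp (ℓ ^ θ) with hydef
  have hy0 : 0 < y := Real.exp_pos _
  rw [primesLE_filter_eq X y]
  set F : Finset ℕ := (Finset.Icc ⌈y⌉₊ ⌊X⌋₊).filter Nat.Prime with hFdef
  -- split the summand
  have hsplit : ∑ p ∈ F, (1 + (χ p * (p : ℂ) ^ ((t : ℂ) * I)).re) / (p : ℝ) =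
      ∑ p ∈ F, (1 : ℝ) / p + ∑ p ∈ F, (1 : ℝ) / p * (χ p * (p : ℂ) ^ ((t : ℂ) * I)).re := by
    rw [← Finset.sum_add_distrib]
    refine Finset.sum_congr rfl fun p _ => ?_
    ring
  have hre : ∑ p ∈ F, (1 : ℝ) / p * (χ p * (p : ℂ) ^ ((t : ℂ) * I)).re =
      (∑ p ∈ F, χ (p : ZMod q) * (p : ℂ) ^ (-(1 + ((-t : ℝ) : ℂ) * I))).re := by
    rw [Complex.re_sum]
    refine Finset.sum_congr rfl fun p hp => ?_
    rw [re_term_eq χ t (Finset.mem_filter.1 hp).2]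
  have h2 : -4 ≤ (∑ p ∈ F, χ (p : ZMod q) * (p : ℂ) ^ (-(1 + ((-t : ℝ) : ℂ) * I))).re :=
    hX₀ X hXX₀ q hqX χ (-t) (by rwa [abs_neg])
  rw [hsplit, hre]
  -- the Mertens part
  rcases lt_or_ge X y with hXy | hyX
  · -- empty range: then `θ > 1`, i.e. `ε > 1/3`, and the bound is trivial
    have hempty : F = ∅ := by
      have hlt : ⌊X⌋₊ < ⌈y⌉₊ := by
        have h1 : (⌊X⌋₊ : ℝ) ≤ X := Nat.floor_le hX0.le
        have h3 : y ≤ ⌈y⌉₊ := Nat.le_ceil y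
        exact_mod_cast (show (⌊X⌋₊ : ℝ) < ⌈y⌉₊ by linarith)
      rw [hFdef, Finset.Icc_eq_empty_of_lt hlt, Finset.filter_empty]
    have hθ1 : 1 < θ := by
      refine lt_of_not_ge fun h => ?_
      have h1 : ℓ ^ θ ≤ ℓ ^ (1 : ℝ) := Real.rpow_le_rpow_of_exponent_le hℓ1 h
      rw [Real.rpow_one] at h1
      have h2 : y ≤ X := by
        calc y = Real.exp (ℓ ^ θ) := rfl
          _ ≤ Real.exp ℓ := Real.exp_le_exp.2 h1
          _ = X := by rw [hℓdef, Real.exp_log hX0]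
      linarith
    rw [hempty, Finset.sum_empty, Finset.sum_empty, Complex.zero_re, add_zero]
    have : (1 / 3 - ε) * Real.log ℓ ≤ 0 :=
      mul_nonpos_of_nonpos_of_nonneg (by rw [hθdef] at hθ1; linarith) hlogℓ
    linarith
  · have hy2 : 2 ≤ y := by
      have h1 : (1 : ℝ) ≤ ℓ ^ θ := Real.one_le_rpow hℓ1 hθ0.le
      have h2 : Real.exp 1 ≤ y := Real.exp_le_exp.2 h1
      have h3 : (2 : ℝ) ≤ Real.exp 1 := by have := Real.add_one_le_exp (1 : ℝ); linarith
      linarith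
    have h1 := MertensBound.loglog_sub_loglog_le_sum_inv_prime_Icc hy2 hyX
    have hlogy : Real.log y = ℓ ^ θ := by rw [hydef, Real.log_exp]
    have hloglogy : Real.log (Real.log y) = θ * Real.log ℓ := by
      rw [hlogy, Real.log_rpow hℓ0]
    have h6 : 6 / Real.log y ≤ 6 := by
      rw [hlogy]
      exact div_le_self (by norm_num) (Real.one_le_rpow hℓ1 hθ0.le)
    rw [hloglogy] at h1
    have h3 : (1 / 3 - ε) * Real.log ℓ - 6 ≤ ∑ p ∈ F, (1 : ℝ) / p := by
      have : Real.log ℓ - θ * Real.log ℓ = (1 / 3 - ε) * Real.log ℓ := by rw [hθdef]; ring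
      linarith
    linarith

/-- **Matomäki–Radziwiłł–Tao 2015, (1.12), from Khale's explicit Vinogradov–Korobov region** (Khale
2024, Theorem 1.1): the specialisation of `MatomakiRadziwillTao2015_liouvilleDistLowerBound_of_vk` to
`HasVKZeroFreeRegion (1/61.5) 10` (`hasVKZeroFreeRegion_of_khale`).
[cite: MatomakiRadziwillTao2015, §1 (1.12) (display following Theorem 1.6)]
[cite: Khale2024, Theorem 1.1] -/
theorem MatomakiRadziwillTao2015_liouvilleDistLowerBound_of_khale (hK : Khale2024_zeroFreeRegion) :
    MatomakiRadziwillTao2015_liouvilleDistLowerBound :=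
  MatomakiRadziwillTao2015_liouvilleDistLowerBound_of_vk (by norm_num) (hasVKZeroFreeRegion_of_khale hK)

/-- **Matomäki–Radziwiłł–Tao 2015, (1.12), from Vinogradov's exponential-sum estimate** in the shape
of Ford's Theorem 2 with unspecified constants (`ExpSumBound C D`:
`‖∑_{N < n ≤ R} (n + u)^{-it}‖ ≤ C N^{1 − (log N)²/(D log² t)}` for `1 ≤ N < R ≤ 2N`, `N ≤ t`,
`0 < u ≤ 1`): exponential sums ⟹ Richert-type bounds for `ζ` and `L(s, χ)` ⟹ the Vinogradov–Korobov
region (`hasVKZeroFreeRegion_of_expSumBound`, `RichertBoundsFromExpSum.lean`) ⟹ (1.12)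
(`MatomakiRadziwillTao2015_liouvilleDistLowerBound_of_vk`).
[cite: MatomakiRadziwillTao2015, §1 (1.12) (display following Theorem 1.6)] [cite: Ford2002, Theorem 2] -/
theorem MatomakiRadziwillTao2015_liouvilleDistLowerBound_of_expSumBound {C D : ℝ}
    (h : ExpSumBound C D) (hC : 0 ≤ C) (hD : 0 < D) :
    MatomakiRadziwillTao2015_liouvilleDistLowerBound := by
  obtain ⟨c, hc, hVK⟩ := hasVKZeroFreeRegion_of_expSumBound h hC hD
  exact MatomakiRadziwillTao2015_liouvilleDistLowerBound_of_vk hc hVK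

/-- **Matomäki–Radziwiłł–Tao 2015, (1.12), from Vinogradov's exponential-sum estimate in its natural
range** `λ = log t/log N ≥ K + 1/2` (`VinogradovRangeBound K C c`; the complementary range is van der
Corput's, `expSumBound_of_vinogradovRange`, `ExpSumBoundReduction.lean`).
[cite: MatomakiRadziwillTao2015, §1 (1.12) (display following Theorem 1.6)] [cite: Ford2002, Theorem 2] -/
theorem MatomakiRadziwillTao2015_liouvilleDistLowerBound_of_vinogradovRange {K : ℕ} (hK : 1 ≤ K)
    {C c : ℝ} (hC : 0 ≤ C) (hc : 0 < c) (h : VinogradovRangeBound K C c) :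
    MatomakiRadziwillTao2015_liouvilleDistLowerBound := by
  obtain ⟨c', hc', hVK⟩ := hasVKZeroFreeRegion_of_vinogradovRange hK hC hc h
  exact MatomakiRadziwillTao2015_liouvilleDistLowerBound_of_vk hc' hVK

/-- **Matomäki–Radziwiłł–Tao 2015, (1.12) — unconditionally.**  The discharge of the named fact
`MatomakiRadziwillTao2015_liouvilleDistLowerBound`: the Vinogradov–Korobov zero-free region for all
Dirichlet `L`-functions in the inexplicit printed shape, `∃ c > 0, HasVKZeroFreeRegion c 21` (Khale (1.4) =
Montgomery, *Ten lectures*, p. 176), is a theorem of the tree — Vinogradov's mean value theorem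
(`vmvtBound_thirtyTwo`, Ivić's Lemma 6.3 with constant `32`) fed into Ivić's Theorem 6.2 for the shifted
zeta sums and the reduction `VinogradovRangeBound → ExpSumBound → Richert-type bounds → zero-free region`
(`VinogradovZetaSum.hasVKZeroFreeRegion_of_vmvtBound`) — and
`MatomakiRadziwillTao2015_liouvilleDistLowerBound_of_vk` takes any such region.  No explicit constant
(Khale's Theorem 1.1) is used.
[cite: MatomakiRadziwillTao2015, §1 (1.12) (display following Theorem 1.6)]
[cite: Ivic1985, Theorem 6.2 and Lemma 6.3] [cite: Khale2024, (1.4)] -/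
theorem MatomakiRadziwillTao2015_liouvilleDistLowerBound_holds :
    MatomakiRadziwillTao2015_liouvilleDistLowerBound := by
  obtain ⟨c, hc, hVK⟩ :=
    VinogradovZetaSum.hasVKZeroFreeRegion_of_vmvtBound (by norm_num) vmvtBound_thirtyTwo
  exact MatomakiRadziwillTao2015_liouvilleDistLowerBound_of_vk hc hVK

end Literature.NumberTheory.LFunctions
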